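import Literature.Computability.Complexity.PlethysmStabilityBIP
import Literature.Computability.Complexity.OccurrenceObstructionsProofs
import Mathlib.LinearAlgebra.Matrix.Permanent
import Mathlib.LinearAlgebra.Matrix.SchurComplement
import Mathlib.Data.Matrix.ColumnRowPartitioned
import HarnessLib

/-!
# `no_occurrence_obstructions` for G20's fresh-variable padding at the threshold `n^25`:
# the parameter analysis, the internal form of BIP Prop. 6.1, and the small permanents

Topic `Literature/Computability/Complexity`, sibling of `OccurrenceObstructions.lean` (the named
fact `Literature.Computability.Complexity.no_occurrence_obstructions`, pnp.S28), `OccurrenceObstructionsBIP.lean` (BIP's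
Theorem 1.4 as printed, `bip2019_no_occurrence_obstructions`, and the architecture of its proof),
`PlethysmStabilityBIP.lean` (Props. 5.6(2), 5.8(2), 2.4, 6.1 discharged) and
`OccurrenceObstructionsProofs.lean` (the occurrence-obstruction principle: occurrence transports
along `Z ⊆ Ω`). Theorems only.

## What is proved, and why it is not verbatim in the source

`no_occurrence_obstructions` is stated for the tree's padded permanent
`paddedPerFormLex ℂ n m = X₀₀^{m-n} · per_n` whose padding variable `X₀₀` is NOT a variable of
`per_n` (a form in `n² + 1` variables), at BIP's threshold `n^25 ≤ m` (letters of the tree: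
permanent `n`, determinant `m`). Bürgisser–Ikenmeyer–Panova (J. AMS 32 (2019) =
arXiv:1604.06431v3, Thm. 1.4) print the theorem for `Z_{n,m}`, the orbit closure of
`X_{11}^{n-m} per_m` padded by a variable OF the permanent (`m²` variables), and their proof (§6,
"Proof of Theorem 1.4") runs on the two shape constraints of Thm. 2.1, `ℓ(λ) ≤ M²` and
`|λ̄| ≤ M d` with `M` = the permanent size, through the parameter windows of Props. 2.4, 6.1, 6.3.
(The fresh padding is the convention of Mulmuley–Sohoni and of BLMW 2011 §1, "`ℓ` is a linear
coordinate on `ℂ`, and one takes any linear inclusion `ℂ ⊕ ℂ^{m²} ⊂ ℂ^{n²}`"; BIP §1: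
"Sometimes the padding is achieved by using a linear form different from `X_{11}`, e.g., but this
is irrelevant, see [26, Appendix]" — irrelevant for the conjectures, which are uniform in
polynomial bounds, but not at the level of a fixed threshold such as `n^25`.) For the fresh
padding the length bound is `ℓ(λ) ≤ n² + 1` (Thm. 4.9(1): number of variables),
which fits BIP's windows only with `M = n + 1`, i.e. from `(n+1)^25 ≤ m` on
(`no_occurrence_obstructions_succ`, `OccurrenceObstructionsBIP.lean`). This file closes the gap
between `n^25` and `(n+1)^25`:

* `not_mem_orbitVanishingIdeal_detFormLex_of_stability` — **the internal form of Props. 2.4/6.1**: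
  BIP's proof of Prop. 6.1 (§6(a)) with its two auxiliary parameters decoupled (inner degree `s`
  with `λ₂ ≤ s`, `λ₂ + |λ̄| ≤ s d`; outer degree `k'` with `λ₂ + |λ̄| ≤ k' ≤ d` or `k' = d`; room
  `s k' ≤ m`), from the discharged Props. 5.6(2), 5.8(2), Prop. 3.2 and Thm. 2.5.
* `hasHighestWeight_detOrbitRep_of_fresh` — **the case analysis for `n ≥ 4`**: small degree
  `n d² ≤ m` (internal 2.4), large degree and small body `|λ̄| < (n+1)^{10}` (internal 6.1 with
  `s = max λ₂ 1`, using `λ₂ + |λ̄| ≤ ℓ(λ) λ₂ ≤ (n²+1) λ₂` and the room `2 (n+1)^{20} ≤ n^{25}`,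
  valid exactly for `n ≥ 4`), large body (BIP Prop. 6.3 with `M = n + 1`, resting on the
  discharged Prop. 2.3 and on Thm. 6.2, which enters as the hypothesis `h62 : bip2019_thm_6_2`).
* `hasBorderDetRepr_of_le_three` — **the small permanents `n ≤ 3`**, where no parameter room is
  left, are settled by `Z ⊆ Ω_m` outright: `dc(per_1) = 1`, `dc(per_2) = 2` and Grenet's
  `dc(per_3) ≤ 7` (`hasDetRepr_perPoly_fin_three`, the `7 × 7` matrix (1.2.3) of Landsberg's
  book, verified by two Schur complements), homogenised into `Ω_m` by Mulmuley–Sohoni 2001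
  Prop. 4.4 (`paddedPerPoly_mem_orbitClosure_detPoly_of_hasDetRepr_holds`); occurrence then
  transports along `Z ⊆ Ω_m` (`hasHighestWeight_orbitCoordRep_of_mem_orbitClosure`,
  `OccurrenceObstructionsProofs.lean`).
* `no_occurrence_obstructions_of_thm_6_2` — **pnp.S28 from Thm. 6.2 alone**; the unconditional
  `no_occurrence_obstructions_holds` follows in `OccurrenceObstructionsThm62.lean`, where
  `bip2019_thm_6_2_holds` is proved.

By-products: the Laplace expansion of the permanent along a column
(`Matrix.permanent_succ_column_zero`, the permanent twin of Mathlib's `Matrix.det_succ_column_zero`)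
with the `2 × 2` and `3 × 3` expansions; `CplxAlg.exists_hasBorderDetRepr_holds` (discharge of the
nonemptiness fact of `OrbitClosure.lean`) and with it the unconditional
`lt_borderDetComplexityPer_of_occurrence_obstruction_holds`.

## References

* P. Bürgisser, C. Ikenmeyer, G. Panova, *No occurrence obstructions in geometric complexity
  theory*, J. AMS 32 (2019) 163–193 = arXiv:1604.06431v3: Thm. 1.4, Thm. 2.1, Props. 2.3, 2.4,
  Thm. 2.5, Prop. 3.2, Thm. 4.9, Props. 5.6, 5.8, §6 (Props. 6.1, 6.3, Thm. 6.2, Proof of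
  Theorem 1.4). [key `BurgisserIkenmeyerPanovaJAMS2019`]
* B. Grenet, *An upper bound for the permanent versus determinant problem*, manuscript (2011):
  `dc(per_n) ≤ 2^n - 1`. [key `GrenetPermDet2011`; interim stub `Grenet2011` in
  `PermanentVsDeterminant.lean`]
* J. M. Landsberg, *Geometry and Complexity Theory*, Cambridge Studies in Advanced Mathematics 169
  (2017), (1.2.3) (Grenet's `7 × 7` expression of `per_3`), §6.6.3. [key `LandsbergGCT2017`]
* K. Mulmuley, M. Sohoni, *Geometric complexity theory I*, SIAM J. Comput. 31 (2001), Prop. 4.4.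
  [key `MulmuleySohoniSIAM2001`]
* P. Bürgisser, J. M. Landsberg, L. Manivel, J. Weyman, *An overview of mathematical issues arising
  in the geometric complexity theory approach to VP ≠ VNP*, SIAM J. Comput. 40 (2011)
  = arXiv:0907.2850, §1 (p. 3: the obstruction principle; the padding `ℓ^{n-m} per_m` with `ℓ`
  "a linear coordinate on `ℂ`" of `ℂ ⊕ ℂ^{m²} ⊂ ℂ^{n²}`, i.e. a FRESH variable — the convention of
  the tree's `paddedPerPoly`, as opposed to BIP's `X_{11}`). [key `BurgisserEtAl2011`]

## Mathlib and tree

Mathlib: `Matrix.permanent` (`permanent_unique`, `permanent_permute_cols`),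
`Finset.univ_perm_fin_succ`, `Equiv.Perm.decomposeFin`, `Fin.succAbove_cycleRange`,
`Matrix.det_fromBlocks_one₂₂`, `Matrix.fromRows_mul_fromCols`, `Matrix.det_reindex_self`,
`Matrix.det_unique`, `Matrix.det_fin_two`. Tree: `HasDetRepr`/`HasDetRepr.mono_holds`,
`paddedPerPoly_mem_orbitClosure_detPoly_of_hasDetRepr_holds`, `exists_hasDetRepr_holds`,
`hasBorderDetRepr_iff_rename_holds`, `hasHighestWeight_orbitCoordRep_of_mem_orbitClosure`,
`bip2019_prop_5_6_2_holds`, `bip2019_prop_5_8_2_holds`, `bip2019_prop_6_3_of_parts`,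
`bip2019_prop_2_3_holds`, `exists_partition_of_hasHighestWeight_paddedPerOrbitRep_holds`,
`kadish_landsberg_padding_holds`, `hasHighestWeight_coordRep_of_orbitCoordRep_holds`.
-/

open MvPolynomial Matrix Equiv

/-! ## 1. Permanents of small matrices -/

namespace Matrix

variable {R : Type*} [CommSemiring R]

/-- **Laplace expansion of the permanent along column `0`** (the permanent twin of Mathlib's
`Matrix.det_succ_column_zero`, same proof without signs: decompose `S_{n+1}` by the image of `0`,
`Finset.univ_perm_fin_succ`, and realign the embedding of `S_n` by the cycle `(0 1 … i)`,
`Fin.succAbove_cycleRange`, `permanent_permute_cols`). [folklore] -/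
theorem permanent_succ_column_zero {n : ℕ} (A : Matrix (Fin n.succ) (Fin n.succ) R) :
    permanent A = ∑ i : Fin n.succ, A i 0 * permanent (A.submatrix i.succAbove Fin.succ) := by
  rw [Matrix.permanent, Finset.univ_perm_fin_succ, ← Finset.univ_product_univ]
  simp only [Finset.sum_map, Equiv.toEmbedding_apply, Finset.sum_product]
  refine Finset.sum_congr rfl fun p _ => ?_
  have key : ∀ τ : Perm (Fin n), ∏ i, A (Perm.decomposeFin.symm (p, τ) i) i =
      A p 0 * ∏ i, A (Equiv.swap 0 p (τ i).succ) i.succ := fun τ => by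
    rw [Fin.prod_univ_succ, Perm.decomposeFin_symm_apply_zero]
    simp only [Perm.decomposeFin_symm_apply_succ]
  simp only [key, ← Finset.mul_sum]
  congr 1
  refine Fin.cases ?_ (fun i => ?_) p
  · simp only [Equiv.swap_self, Equiv.refl_apply, Matrix.permanent, submatrix_apply,
      Fin.succAbove_zero]
  · rw [← permanent_permute_cols i.cycleRange, Matrix.permanent]
    refine Finset.sum_congr rfl fun τ _ => Finset.prod_congr rfl fun j _ => ?_
    simp only [submatrix_apply, id, Fin.succAbove_cycleRange]

/-- The permanent of a `2 × 2` matrix. [folklore] -/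
theorem permanent_fin_two' (A : Matrix (Fin 2) (Fin 2) R) :
    permanent A = A 0 0 * A 1 1 + A 1 0 * A 0 1 := by
  rw [permanent_succ_column_zero, Fin.sum_univ_two, permanent_unique, permanent_unique]
  simp [submatrix_apply, Fin.succAbove, Fin.default_eq_zero]

/-- The permanent of a `3 × 3` matrix, expanded along column `0`. [folklore] -/
theorem permanent_fin_three' (A : Matrix (Fin 3) (Fin 3) R) :
    permanent A = A 0 0 * (A 1 1 * A 2 2 + A 2 1 * A 1 2) +
      A 1 0 * (A 0 1 * A 2 2 + A 2 1 * A 0 2) + A 2 0 * (A 0 1 * A 1 2 + A 1 1 * A 0 2) := by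
  rw [permanent_succ_column_zero, Fin.sum_univ_three, permanent_fin_two', permanent_fin_two',
    permanent_fin_two']
  simp [submatrix_apply, Fin.succAbove]

end Matrix

namespace Literature.Computability.Complexity

variable {k : Type*} [CommRing k]

/-- `dc(per_1) ≤ 1`: `per_1 = X₀₀ = det (X₀₀)`. [folklore] -/
theorem hasDetRepr_perPoly_fin_one : AlgebraicComplexity.HasDetRepr (AlgebraicComplexity.perPoly (Fin 1) k) 1 := by
  refine ⟨Matrix.mvPolynomialX (Fin 1) (Fin 1) k, fun i j => ?_, ?_⟩
  · rw [Matrix.mvPolynomialX_apply]; exact (isHomogeneous_X k _).totalDegree_le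
  · rw [Matrix.det_unique, AlgebraicComplexity.perPoly, Matrix.permanent_unique]

/-- `dc(per_2) ≤ 2`: `per_2 = det [[X₀₀, -X₀₁], [X₁₀, X₁₁]]`. [folklore] -/
theorem hasDetRepr_perPoly_fin_two : AlgebraicComplexity.HasDetRepr (AlgebraicComplexity.perPoly (Fin 2) k) 2 := by
  have hX : ∀ p : Fin 2 × Fin 2, (X p : MvPolynomial (Fin 2 × Fin 2) k).totalDegree ≤ 1 :=
    fun p => (isHomogeneous_X k p).totalDegree_le
  refine ⟨of fun i j => if i = 0 ∧ j = 1 then -X (i, j) else X (i, j), fun i j => ?_, ?_⟩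
  · rw [of_apply]
    split_ifs
    · rw [totalDegree_neg]; exact hX _
    · exact hX _
  · rw [Matrix.det_fin_two, AlgebraicComplexity.perPoly, Matrix.permanent_fin_two']
    simp +decide [Matrix.mvPolynomialX_apply, of_apply]
    ring

/-- **`dc(per_3) ≤ 7` (Grenet 2011, the case `n = 3` of `dc(per_n) ≤ 2^n - 1`; the `7 × 7`
expression (1.2.3) of Landsberg's book).** An explicit `7 × 7` matrix with entries `0`, `1` and
variables, in block form `M = [[A, B'], [C', 1₃]]` with `A = [[0, a], [0, 1₃]]` (`a` the row
`(X₀₀, X₁₀, X₂₀)`), `B' = [[0], [B]]` (`B_{ij} = X_{l1}` for `{i, j, l} = {0, 1, 2}`, zero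
diagonal) and `C' = [c | 0]` (`c` the column `(X₀₂, X₁₂, X₂₂)`); two Schur complements
(`det_fromBlocks_one₂₂`) give `det M = det (A - B' C') = a B c = ∑_{i ≠ j} X_{i0} X_{l1} X_{j2}
= per_3` (expansion along column `0`). Up to transposition and the order of the blocks this is
the matrix printed as (1.2.3) in Landsberg 2017 ("This formula is due to B. Grenet [Gre11]");
Grenet's general construction is the named fact `determinantalComplexity_perPoly_le`
(`PermanentVsDeterminant.lean`, key `Grenet2011` = `GrenetPermDet2011`).
[cite: LandsbergGCT2017, (1.2.3)] -/
theorem hasDetRepr_perPoly_fin_three : AlgebraicComplexity.HasDetRepr (AlgebraicComplexity.perPoly (Fin 3) k) 7 := by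
  classical
  let R := MvPolynomial (Fin 3 × Fin 3) k
  let a : Matrix (Fin 1) (Fin 3) R := of fun _ j => X (j, 0)
  let B : Matrix (Fin 3) (Fin 3) R := of fun i j => if i = j then 0 else X (-(i + j), 1)
  let c : Matrix (Fin 3) (Fin 1) R := of fun i _ => X (i, 2)
  let M : Matrix ((Fin 1 ⊕ Fin 3) ⊕ Fin 3) ((Fin 1 ⊕ Fin 3) ⊕ Fin 3) R :=
    fromBlocks (fromBlocks 0 a 0 1) (fromRows 0 B) (fromCols c 0) 1
  let e : (Fin 1 ⊕ Fin 3) ⊕ Fin 3 ≃ Fin 7 :=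
    (Equiv.sumCongr finSumFinEquiv (Equiv.refl _)).trans finSumFinEquiv
  refine ⟨reindex e e M, fun i j => ?_, ?_⟩
  · rw [reindex_apply, submatrix_apply]
    generalize e.symm i = i'
    generalize e.symm j = j'
    have hX : ∀ p : Fin 3 × Fin 3, (X p : R).totalDegree ≤ 1 := fun p =>
      (isHomogeneous_X k p).totalDegree_le
    rcases i' with ((i' | i') | i') <;> rcases j' with ((j' | j') | j') <;>
      simp only [M, a, B, c, fromBlocks_apply₁₁, fromBlocks_apply₁₂, fromBlocks_apply₂₁,
        fromBlocks_apply₂₂, fromRows_apply_inl, fromRows_apply_inr, fromCols_apply_inl,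
        fromCols_apply_inr, of_apply, Matrix.zero_apply, one_apply, totalDegree_zero, zero_le, hX] <;>
      split_ifs <;> simp [hX]
  · rw [det_reindex_self, det_fromBlocks_one₂₂, fromRows_mul_fromCols]
    have h1 : fromBlocks 0 a 0 (1 : Matrix (Fin 3) (Fin 3) R) -
        fromBlocks ((0 : Matrix (Fin 1) (Fin 3) R) * c)
          ((0 : Matrix (Fin 1) (Fin 3) R) * (0 : Matrix (Fin 3) (Fin 3) R))
          (B * c) (B * (0 : Matrix (Fin 3) (Fin 3) R)) =
        fromBlocks 0 a (-(B * c)) 1 := by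
      rw [Matrix.zero_mul, Matrix.zero_mul, Matrix.mul_zero, sub_eq_add_neg, fromBlocks_neg,
        fromBlocks_add]
      simp
    rw [h1, det_fromBlocks_one₂₂, det_unique]
    have e01 : (-((0 : Fin 3) + 1) : Fin 3) = 2 := rfl
    have e02 : (-((0 : Fin 3) + 2) : Fin 3) = 1 := rfl
    have e10 : (-((1 : Fin 3) + 0) : Fin 3) = 2 := rfl
    have e12 : (-((1 : Fin 3) + 2) : Fin 3) = 0 := rfl
    have e20 : (-((2 : Fin 3) + 0) : Fin 3) = 1 := rfl
    have e21 : (-((2 : Fin 3) + 1) : Fin 3) = 0 := rfl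
    simp only [Matrix.sub_apply, Matrix.zero_apply, Matrix.mul_neg, Matrix.neg_apply, mul_apply,
      Fin.sum_univ_three, a, B, c, of_apply, Fin.default_eq_zero, zero_sub]
    rw [AlgebraicComplexity.perPoly, Matrix.permanent_fin_three']
    simp +decide only [Matrix.mvPolynomialX_apply, e01, e02, e10, e12, e20, e21, if_true, if_false]
    ring

end Literature.Computability.Complexity

/-! ## 2. `Z ⊆ Ω` and the transfer of occurrence -/

namespace Literature.Computability.Complexity

variable {k : Type*} [Field k]

/-- **Discharge of `exists_hasBorderDetRepr`** (`OrbitClosure.lean`): over an infinite field the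
set defining `borderDetComplexityPer k n` is nonempty — Valiant universality
(`exists_hasDetRepr_holds`), padding (`HasDetRepr.mono_holds`) and Mulmuley–Sohoni 2001 Prop. 4.4
(`paddedPerPoly_mem_orbitClosure_detPoly_of_hasDetRepr_holds`); the preserved interim proof.
[cite: MulmuleySohoniSIAM2001, Prop. 4.4] -/
theorem exists_hasBorderDetRepr_holds : AlgebraicComplexity.exists_hasBorderDetRepr (k := k) := by
  intro _ n
  obtain ⟨m, hm⟩ := AlgebraicComplexity.exists_hasDetRepr_holds (AlgebraicComplexity.perPoly (Fin n) k)
  refine ⟨max m (n + 1), by omega, by omega, ?_⟩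
  haveI : NeZero (max m (n + 1)) := NeZero.of_pos (by omega)
  exact AlgebraicComplexity.paddedPerPoly_mem_orbitClosure_detPoly_of_hasDetRepr_holds
    (AlgebraicComplexity.HasDetRepr.mono_holds hm (le_max_left _ _)) (by omega)

end Literature.Computability.Complexity

namespace Literature.Computability.Complexity

/-- **Occurrence transports along `Z ⊆ Ω_m`** for G20's padded permanent: if
`X₀₀^{m-n} per_n ∈ Ω_m` (`HasBorderDetRepr ℂ n m`, moved to the lexicographic variables by
`hasBorderDetRepr_iff_rename_holds`) then every highest weight of `ℂ[Z]` occurs in `ℂ[Ω_m]`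
(`CplxAlg.hasHighestWeight_orbitCoordRep_of_mem_orbitClosure`, `OccurrenceObstructionsProofs.lean`:
complete reducibility of `ℂ[Ω_m]`). BLMW 2011 §1 ("one has `X ⊂ Y` iff `ℂ[Y]` surjects onto
`ℂ[X]` ... by Schur's lemma", arXiv:0907.2850 p. 3); BIP §1.
[cite: BurgisserEtAl2011, §1 (arXiv:0907.2850 p. 3)] -/
theorem hasHighestWeight_detOrbitRep_of_hasBorderDetRepr {n m : ℕ} [NeZero m]
    (hB : AlgebraicComplexity.HasBorderDetRepr ℂ n m) {χ : Literature.NumberTheory.DiophantineGeometry.Weight (Literature.NumberTheory.DiophantineGeometry.MatIdx m)}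
    (h : Literature.NumberTheory.DiophantineGeometry.HasHighestWeight (Literature.NumberTheory.DiophantineGeometry.paddedPerOrbitRep ℂ n m) χ) :
    Literature.NumberTheory.DiophantineGeometry.HasHighestWeight (Literature.NumberTheory.DiophantineGeometry.detOrbitRep ℂ m) χ :=
  Complexity.hasHighestWeight_orbitCoordRep_of_mem_orbitClosure
    ((Literature.NumberTheory.DiophantineGeometry.hasBorderDetRepr_iff_rename_holds n m).mp hB) h

/-- **Discharge of `lt_borderDetComplexityPer_of_occurrence_obstruction`**: the conditional form
`lt_borderDetComplexityPer_of_occurrence_obstruction_of_exists` of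
`OccurrenceObstructionsProofs.lean` fed with `CplxAlg.exists_hasBorderDetRepr_holds`.
Mulmuley–Sohoni 2001 §4; BLMW 2011 §3.3. [cite: MulmuleySohoniSIAM2001, §4] -/
theorem lt_borderDetComplexityPer_of_occurrence_obstruction_holds :
    lt_borderDetComplexityPer_of_occurrence_obstruction :=
  lt_borderDetComplexityPer_of_occurrence_obstruction_of_exists Complexity.exists_hasBorderDetRepr_holds

end Literature.Computability.Complexity

/-! ## 3. The internal form of BIP Prop. 6.1 and the parameter analysis for `n ≥ 4` -/

namespace Literature.Computability.Complexity

/-- **BIP Prop. 6.1 / Prop. 2.4 with decoupled parameters (the internal form of BIP §6(a)).**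
Let `λ ⊢ d·m` (at most `m²` parts) and `v ≠ 0` a highest-weight vector of weight `λ^*` in
`ℂ[Sym^m ℂ^{m×m}]`. Suppose `0 < s`, `λ₂ ≤ s`, `λ₂ + |λ̄| ≤ s d` (inner stability, Prop. 5.6(2):
`v` is lifted from inner degree `s`), and `1 ≤ k' ≤ d` with either `λ₂ + |λ̄| ≤ k'` (outer
stability, Prop. 5.8(2): lifted from outer degree `k'`) or `k' = d` (no outer lifting, as in the
proof of Prop. 2.4), and `s k' ≤ m` (Thm. 2.5: padded power sums of `k'` `s`-th powers lie in
`Ω_m`). Then `v` does not vanish on `Ω_m`. This is exactly the printed proof of Prop. 6.1 (§6(a)),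
which specialises `k' = M² s`; stated with free `(s, k')` it also covers Prop. 2.4 (`s = M d`,
`k' = d`). [cite: BurgisserIkenmeyerPanovaJAMS2019, §6(a) (proofs of Props. 2.4 and 6.1)] -/
theorem not_mem_orbitVanishingIdeal_detFormLex_of_stability {m d s k' : ℕ} [NeZero m] (hs : 0 < s)
    (lam : Nat.Partition (d * m)) (hlam : lam.parts.card ≤ m * m) (h₂ : secondPart lam ≤ s)
    (hb : secondPart lam + bodySize lam ≤ s * d)
    (hk : secondPart lam + bodySize lam ≤ k' ∨ k' = d) (hk1 : 1 ≤ k') (hkd : k' ≤ d)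
    (hsk : s * k' ≤ m)
    {v : MvPolynomial (AlgebraicComplexity.DegIdx (Literature.NumberTheory.DiophantineGeometry.MatIdx m) m) ℂ}
    (hv : v ∈ Literature.NumberTheory.DiophantineGeometry.highestWeightSpace (AlgebraicComplexity.coordRep (Literature.NumberTheory.DiophantineGeometry.MatIdx m) ℂ m)
      (partitionWeightLex m lam))
    (hv0 : v ≠ 0) :
    v ∉ AlgebraicComplexity.orbitVanishingIdeal (Literature.NumberTheory.DiophantineGeometry.detFormLex ℂ m) m := by
  classical
  have hm0 : m ≠ 0 := NeZero.ne m
  set iₘ := topMatIdx m with hiₘ'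
  have hiₘ : ∀ i, i ≤ iₘ := le_topMatIdx m
  have hsm' : s ≤ m := (Nat.le_mul_of_pos_right s hk1).trans hsk
  -- `v` is a form of degree `d`
  have hvd : v.IsHomogeneous d :=
    AlgebraicComplexity.isHomogeneous_of_mem_highestWeightSpace hm0 hv (size_partitionWeightLex lam hlam)
  -- inner lifting from `Sym^s` (Prop. 5.6(2))
  obtain ⟨mu, f, hmuN, hmubody, hfd, hfw, hvf⟩ :=
    bip2019_prop_5_6_2_holds m s m d hsm' lam hlam h₂ hb v hvd hv
  -- outer lifting from degree `k'` (Prop. 5.8(2)), or none if `k' = d`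
  obtain ⟨g, hgd, hfg⟩ : ∃ g : MvPolynomial (AlgebraicComplexity.DegIdx (Literature.NumberTheory.DiophantineGeometry.MatIdx m) s) ℂ,
      g.IsHomogeneous k' ∧ f = X (topDegIdx m s) ^ (d - k') * g := by
    rcases hk with hk | rfl
    · have hkmu : secondPart mu + bodySize mu ≤ k' := by
        rw [secondPart_add_bodySize_eq_of_erase_eq hmubody]; exact hk
      obtain ⟨nu, g, -, -, hgd, -, hfg⟩ := bip2019_prop_5_8_2_holds m s d k' mu hmuN hkmu hkd f hfd hfw
      exact ⟨g, hgd, hfg⟩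
    · exact ⟨f, hfd, by simp⟩
  have hg0 : g ≠ 0 := by
    rintro rfl
    exact hv0 (by rw [hvf, hfg, mul_zero, map_zero])
  -- `g ∘ Δ` and `X_{x_{iₘ}^s} ∘ Δ`, with a common good power sum of `k'` terms (Prop. 3.2)
  obtain ⟨G, hG⟩ : ∃ G : MvPolynomial (AlgebraicComplexity.DegIdx (Literature.NumberTheory.DiophantineGeometry.MatIdx m) s) ℂ,
      G = aeval (fun e : AlgebraicComplexity.DegIdx (Literature.NumberTheory.DiophantineGeometry.MatIdx m) s =>
        C (((e.1 iₘ + (m - s)).descFactorial (m - s) : ℕ) : ℂ) * X e) g := ⟨_, rfl⟩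
  have hsupp := AlgebraicComplexity.support_aeval_C_mul_X
    (fun e : AlgebraicComplexity.DegIdx (Literature.NumberTheory.DiophantineGeometry.MatIdx m) s => (((e.1 iₘ + (m - s)).descFactorial (m - s) : ℕ) : ℂ))
    (fun e => Nat.cast_ne_zero.mpr (AlgebraicComplexity.descFactorial_add_pos _ _).ne') g
  rw [← hG] at hsupp
  have hG0 : G ≠ 0 := by
    intro h0; apply hg0; rw [← support_eq_empty, ← hsupp, h0, support_zero]
  have hGdeg : G.totalDegree ≤ k' :=
    (totalDegree_le_of_support_subset hsupp.le).trans (hgd.totalDegree hg0).le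
  have hXdeg : (X (topDegIdx m s) : MvPolynomial (AlgebraicComplexity.DegIdx (Literature.NumberTheory.DiophantineGeometry.MatIdx m) s) ℂ).totalDegree
      ≤ k' := by rw [totalDegree_X]; exact hk1
  obtain ⟨φ, hφG, hφX⟩ := AlgebraicComplexity.exists_aeval_formCoeff_sum_linearFormPow_ne_zero_and hs G
    (X (topDegIdx m s)) hG0 (X_ne_zero _) hGdeg hXdeg
  rw [aeval_X] at hφX
  obtain ⟨p, hp⟩ : ∃ p : MvPolynomial (Literature.NumberTheory.DiophantineGeometry.MatIdx m) ℂ,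
      p = ∑ i, (∑ x, C (φ i x) * X x) ^ s := ⟨_, rfl⟩
  rw [← hp] at hφG hφX
  have hphom : p.IsHomogeneous s := by rw [hp]; exact Complexity.isHomogeneous_sum_linearFormPow φ s
  obtain ⟨q, hq⟩ : ∃ q : MvPolynomial (Literature.NumberTheory.DiophantineGeometry.MatIdx m) ℂ, q = X iₘ ^ (m - s) * p := ⟨_, rfl⟩
  have hqhom : q.IsHomogeneous m := by
    have := (isHomogeneous_X_pow (R := ℂ) iₘ (m - s)).mul hphom
    rwa [Nat.sub_add_cancel hsm', ← hq] at this
  have hqmem : q ∈ AlgebraicComplexity.orbitClosure (Literature.NumberTheory.DiophantineGeometry.detFormLex ℂ m) := by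
    rw [hq, hp]
    exact Complexity.X_pow_mul_sum_linearFormPow_mem_orbitClosure_detFormLex (s := s) (r := k')
      hsk iₘ φ
  -- `v(q) = f(Δ p) = (X_{x^s}(Δ p))^{d-k'} · g(Δ p) ≠ 0`
  have hvq : aeval (AlgebraicComplexity.formCoeff m q) v ≠ 0 := by
    rw [hvf, AlgebraicComplexity.aeval_formCoeff_innerLift iₘ hqhom, hq,
      AlgebraicComplexity.aeval_formCoeff_iterPderiv_X_pow_mul iₘ (m - s) hphom, hfg, map_mul, map_pow,
      map_mul, map_pow, ← hG]
    refine mul_ne_zero (pow_ne_zero _ ?_) hφG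
    rw [aeval_X, map_mul, aeval_C, aeval_X, Algebra.algebraMap_self_apply]
    exact mul_ne_zero (Nat.cast_ne_zero.mpr (AlgebraicComplexity.descFactorial_add_pos _ _).ne') hφX
  intro hvI
  exact hvq (Complexity.aeval_formCoeff_eq_zero_of_mem_orbitClosure_detFormLex hqmem hvI)

/-- `2 (n+1)^20 ≤ n^25` for `n ≥ 4` (the parameter room of the fresh-variable padding: the
products `s k'` of the internal Prop. 6.1 stay below the threshold `n^25`). [folklore] -/
theorem two_mul_succ_pow_twenty_le {n : ℕ} (hn : 4 ≤ n) : 2 * (n + 1) ^ 20 ≤ n ^ 25 := by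
  have h1 : 4 * (n + 1) ≤ 5 * n := by omega
  have h2 : (4 * (n + 1)) ^ 20 ≤ (5 * n) ^ 20 := Nat.pow_le_pow_left h1 20
  have h3 : 4 ^ 5 ≤ n ^ 5 := Nat.pow_le_pow_left hn 5
  have h4 : 2 * 5 ^ 20 ≤ 4 ^ 20 * n ^ 5 := by
    calc 2 * 5 ^ 20 ≤ 4 ^ 20 * 4 ^ 5 := by norm_num
      _ ≤ 4 ^ 20 * n ^ 5 := Nat.mul_le_mul_left _ h3
  have h5 : 4 ^ 20 * (2 * (n + 1) ^ 20) ≤ 4 ^ 20 * n ^ 25 := by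
    calc 4 ^ 20 * (2 * (n + 1) ^ 20) = 2 * (4 * (n + 1)) ^ 20 := by ring
      _ ≤ 2 * (5 * n) ^ 20 := Nat.mul_le_mul_left _ h2
      _ = 2 * 5 ^ 20 * n ^ 20 := by ring
      _ ≤ 4 ^ 20 * n ^ 5 * n ^ 20 := Nat.mul_le_mul_right _ h4
      _ = 4 ^ 20 * n ^ 25 := by ring
  exact Nat.le_of_mul_le_mul_left h5 (by positivity)

/-- `64 (n+1)^6 ≤ n^12` for `n ≥ 3`. [folklore] -/
theorem succ_pow_six_le {n : ℕ} (hn : 3 ≤ n) : 64 * (n + 1) ^ 6 ≤ n ^ 12 := by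
  have h1 : 2 * (n + 1) ≤ n ^ 2 := by nlinarith
  calc 64 * (n + 1) ^ 6 = (2 * (n + 1)) ^ 6 := by ring
    _ ≤ (n ^ 2) ^ 6 := Nat.pow_le_pow_left h1 6
    _ = n ^ 12 := by ring

/-- **The core of `no_occurrence_obstructions` for the fresh-variable padding, `n ≥ 4`.** Let
`4 ≤ n`, `n^25 ≤ m`, `λ ⊢ d·m` with `ℓ(λ) ≤ n² + 1` and `|λ̄| ≤ n d`, occurring in
`ℂ[Sym^m ℂ^{m×m}]`. Then `λ` occurs in `ℂ[Ω_m]`. BIP's case analysis (§6, Proof of Thm. 1.4) run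
with the internal form of Props. 2.4/6.1 (`not_mem_orbitVanishingIdeal_detFormLex_of_stability`)
and Prop. 6.3 with `M = n + 1`: (1) `n d² ≤ m`: `(s, k') = (n d, d)` (`d ≥ 2`) or `(2n, 1)`
(`d = 1`); (2) `m < n d²`, so `d > n^{12}`: (2a) `|λ̄| < (n+1)^{10}`: `s = max λ₂ 1`,
`k' = max (λ₂ + |λ̄|) 1` if `λ₂ + |λ̄| ≤ d`, else `k' = d`; here `λ₂ + |λ̄| ≤ ℓ(λ) λ₂ ≤ (n²+1) λ₂ ≤ d λ₂`
and `s k' ≤ 2 (n+1)^{20} ≤ n^{25} ≤ m` (this is where `n ≥ 4` is used); (2b)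
`|λ̄| ≥ (n+1)^{10}`: Prop. 6.3 with `M = n + 1` (`ℓ(λ) ≤ (n+1)²`, `24 (n+1)^6 ≤ n^{12} ≤ m`,
`4 (n+1)^6 < n^{12} < d`). The printed theorem (BIP padding, `ℓ(λ) ≤ n²`) is the case `M = n`
of BIP's own analysis; the fresh padding allows `ℓ(λ) = n² + 1`, which BIP's printed parameter
windows accommodate only from `(n+1)^25 ≤ m` on (`no_occurrence_obstructions_succ`).
[cite: BurgisserIkenmeyerPanovaJAMS2019, §6 (Proof of Theorem 1.4), adapted] -/
theorem hasHighestWeight_detOrbitRep_of_fresh (h62 : bip2019_thm_6_2) {n m d : ℕ} [NeZero m] (hn : 4 ≤ n)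
    (hnm : n ^ 25 ≤ m) (lam : Nat.Partition (d * m)) (hℓ : lam.parts.card ≤ n ^ 2 + 1)
    (hbody : bodySize lam ≤ n * d)
    (hocc : Literature.NumberTheory.DiophantineGeometry.HasHighestWeight (AlgebraicComplexity.coordRep (Literature.NumberTheory.DiophantineGeometry.MatIdx m) ℂ m)
      (partitionWeightLex m lam)) :
    Literature.NumberTheory.DiophantineGeometry.HasHighestWeight (Literature.NumberTheory.DiophantineGeometry.detOrbitRep ℂ m) (partitionWeightLex m lam) := by
  have hn1 : 1 ≤ n := by omega
  have hn12 : n ^ 12 ≤ n ^ 25 := Nat.pow_le_pow_right hn1 (by norm_num)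
  have h2sq : n ^ 2 + 1 ≤ n ^ 12 := by
    have : n ^ 2 + 1 ≤ n ^ 2 * 2 := by nlinarith
    calc n ^ 2 + 1 ≤ n ^ 2 * 2 := this
      _ ≤ n ^ 2 * n ^ 10 := Nat.mul_le_mul_left _ (le_trans (by omega : 2 ≤ n) (Nat.le_self_pow (by norm_num) n))
      _ = n ^ 12 := by ring
  have hlam : lam.parts.card ≤ m * m :=
    hℓ.trans ((h2sq.trans (hn12.trans hnm)).trans (Nat.le_mul_self m))
  -- degree 0: the trivial weight
  rcases Nat.eq_zero_or_pos d with rfl | hd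
  · rw [partitionWeightLex_eq_zero m lam (Nat.zero_mul m)]
    exact Complexity.hasHighestWeight_orbitCoordRep_zero _ m
  -- a nonzero highest-weight vector
  obtain ⟨v, hv0, hv⟩ := (Literature.NumberTheory.DiophantineGeometry.hasHighestWeight_iff_exists _ _).mp hocc
  -- bookkeeping: `λ₂ ≤ |λ̄| ≤ (ℓ - 1) λ₂`
  have h2b : secondPart lam ≤ bodySize lam := secondPart_le_bodySize lam
  have hbℓ : secondPart lam + bodySize lam ≤ (n ^ 2 + 1) * secondPart lam := by
    have h1 := bodySize_le_card_sub_one_mul_secondPart lam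
    have h3 : (lam.parts.card - 1) * secondPart lam + secondPart lam ≤ (n ^ 2 + 1) * secondPart lam := by
      calc (lam.parts.card - 1) * secondPart lam + secondPart lam
          = (lam.parts.card - 1 + 1) * secondPart lam := by ring
        _ ≤ (n ^ 2 + 1) * secondPart lam := Nat.mul_le_mul_right _ (by omega)
    omega
  by_cases hA : n * d ^ 2 ≤ m
  · -- (1) small degree
    refine Complexity.hasHighestWeight_orbitCoordRep_of_not_mem _ m hv ?_
    rcases Nat.lt_or_ge d 2 with hd1 | hd2
    · -- `d = 1`: `(s, k') = (2n, 1)`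
      have hd1' : d = 1 := by omega
      subst hd1'
      refine not_mem_orbitVanishingIdeal_detFormLex_of_stability (s := 2 * n) (k' := 1)
        (by omega) lam hlam (by omega) (by omega) (Or.inr rfl) le_rfl le_rfl ?_ hv hv0
      calc 2 * n * 1 = 2 * n := by ring
        _ ≤ n * n := by nlinarith
        _ ≤ n ^ 25 := by
          calc n * n = n ^ 2 := by ring
            _ ≤ n ^ 25 := Nat.pow_le_pow_right hn1 (by norm_num)
        _ ≤ m := hnm
    · -- `d ≥ 2`: `(s, k') = (n d, d)`
      refine not_mem_orbitVanishingIdeal_detFormLex_of_stability (s := n * d) (k' := d)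
        (Nat.mul_pos (by omega) hd) lam hlam (h2b.trans hbody) ?_ (Or.inr rfl) hd le_rfl ?_ hv hv0
      · calc secondPart lam + bodySize lam ≤ 2 * (n * d) := by omega
          _ ≤ d * (n * d) := Nat.mul_le_mul_right _ hd2
          _ = n * d * d := by ring
      · calc n * d * d = n * d ^ 2 := by ring
          _ ≤ m := hA
  -- (2) large degree: `n ^ 12 < d`
  have hd12 : n ^ 12 < d := by
    have h1 : n * n ^ 24 < n * d ^ 2 := by
      calc n * n ^ 24 = n ^ 25 := by ring
        _ ≤ m := hnm
        _ < n * d ^ 2 := Nat.lt_of_not_le hA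
    have h2 : (n ^ 12) ^ 2 < d ^ 2 := by
      have := Nat.lt_of_mul_lt_mul_left h1
      calc (n ^ 12) ^ 2 = n ^ 24 := by ring
        _ < d ^ 2 := this
    exact lt_of_pow_lt_pow_left₀ 2 (Nat.zero_le d) h2
  by_cases hB : bodySize lam < (n + 1) ^ 10
  · -- (2a) small body: internal Prop. 6.1 with `s = max λ₂ 1`
    refine Complexity.hasHighestWeight_orbitCoordRep_of_not_mem _ m hv ?_
    have hsd : secondPart lam + bodySize lam ≤ max (secondPart lam) 1 * d := by
      calc secondPart lam + bodySize lam ≤ (n ^ 2 + 1) * secondPart lam := hbℓ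
        _ ≤ d * secondPart lam := Nat.mul_le_mul_right _ (h2sq.trans hd12.le)
        _ ≤ d * max (secondPart lam) 1 := Nat.mul_le_mul_left _ (le_max_left _ _)
        _ = max (secondPart lam) 1 * d := mul_comm _ _
    have hs10 : max (secondPart lam) 1 ≤ (n + 1) ^ 10 :=
      max_le (h2b.trans hB.le) (Nat.one_le_pow _ _ (Nat.succ_pos n))
    have hroom : (n + 1) ^ 10 * (2 * (n + 1) ^ 10) ≤ m := by
      calc (n + 1) ^ 10 * (2 * (n + 1) ^ 10) = 2 * (n + 1) ^ 20 := by ring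
        _ ≤ n ^ 25 := two_mul_succ_pow_twenty_le hn
        _ ≤ m := hnm
    by_cases hkb : secondPart lam + bodySize lam ≤ d
    · refine not_mem_orbitVanishingIdeal_detFormLex_of_stability
        (s := max (secondPart lam) 1) (k' := max (secondPart lam + bodySize lam) 1)
        (lt_max_of_lt_right Nat.one_pos) lam hlam (le_max_left _ _) hsd (Or.inl (le_max_left _ _))
        (le_max_right _ _) (max_le hkb hd) ?_ hv hv0
      have hk2 : max (secondPart lam + bodySize lam) 1 ≤ 2 * (n + 1) ^ 10 :=
        max_le (by omega) (by nlinarith [Nat.one_le_pow 10 (n + 1) (Nat.succ_pos n)])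
      exact (Nat.mul_le_mul hs10 hk2).trans hroom
    · refine not_mem_orbitVanishingIdeal_detFormLex_of_stability
        (s := max (secondPart lam) 1) (k' := d)
        (lt_max_of_lt_right Nat.one_pos) lam hlam (le_max_left _ _) hsd (Or.inr rfl) hd le_rfl ?_ hv hv0
      have hdk : d ≤ 2 * (n + 1) ^ 10 := by omega
      exact (Nat.mul_le_mul hs10 hdk).trans hroom
  · -- (2b) large body: Prop. 6.3 with `M = n + 1`
    have hB' : (n + 1) ^ 10 ≤ bodySize lam := Nat.le_of_not_lt hB
    have h64 : 64 * (n + 1) ^ 6 ≤ n ^ 12 := succ_pow_six_le (by omega)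
    have hm24 : 24 * (n + 1) ^ 6 ≤ m := by
      calc 24 * (n + 1) ^ 6 ≤ 64 * (n + 1) ^ 6 := Nat.mul_le_mul_right _ (by norm_num)
        _ ≤ n ^ 12 := h64
        _ ≤ n ^ 25 := hn12
        _ ≤ m := hnm
    have hd4 : 4 * (n + 1) ^ 6 < d := by
      have hpos : 0 < (n + 1) ^ 6 := pow_pos (Nat.succ_pos n) 6
      calc 4 * (n + 1) ^ 6 < 64 * (n + 1) ^ 6 := by omega
        _ ≤ n ^ 12 := h64
        _ < d := hd12
    have hℓ' : lam.parts.card ≤ (n + 1) ^ 2 := hℓ.trans (by nlinarith)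
    have hbody' : bodySize lam ≤ (n + 1) * d := hbody.trans (Nat.mul_le_mul_right _ (Nat.le_succ n))
    exact bip2019_prop_6_3_of_parts bip2019_prop_2_3_holds h62 m d (n + 1) (by omega) lam hℓ' hB'
      hbody' hm24 hd4

end Literature.Computability.Complexity

/-! ## 4. `no_occurrence_obstructions` from Thm. 6.2 -/

namespace Literature.Computability.Complexity

/-- **`Z ⊆ Ω_m` for the small permanents**: for `1 ≤ n ≤ 3` and `n^25 ≤ m` (indeed `m ≥ n` and
`m ≥ 7` suffice) the padded permanent `X₀₀^{m-n} per_n` lies in `Ω_m`, because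
`dc(per_1) = 1`, `dc(per_2) = 2`, `dc(per_3) ≤ 7` (Grenet 2011) and an affine determinantal
representation of size `≤ m` homogenises into a point of `End · det_m ⊆ Ω_m` (Mulmuley–Sohoni
2001 Prop. 4.4, `paddedPerPoly_mem_orbitClosure_detPoly_of_hasDetRepr_holds`).
[cite: MulmuleySohoniSIAM2001, Prop. 4.4] -/
theorem hasBorderDetRepr_of_le_three {n m : ℕ} [NeZero m] (hn : 0 < n) (hn3 : n ≤ 3)
    (hnm : n ^ 25 ≤ m) : AlgebraicComplexity.HasBorderDetRepr ℂ n m := by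
  have hnm' : n ≤ m := (Nat.le_self_pow (by norm_num) n).trans hnm
  have hrep : AlgebraicComplexity.HasDetRepr (AlgebraicComplexity.perPoly (Fin n) ℂ) m := by
    interval_cases n
    · exact AlgebraicComplexity.HasDetRepr.mono_holds Complexity.hasDetRepr_perPoly_fin_one hnm'
    · exact AlgebraicComplexity.HasDetRepr.mono_holds Complexity.hasDetRepr_perPoly_fin_two hnm'
    · exact AlgebraicComplexity.HasDetRepr.mono_holds Complexity.hasDetRepr_perPoly_fin_three
        (le_trans (by norm_num) hnm)
  exact AlgebraicComplexity.paddedPerPoly_mem_orbitClosure_detPoly_of_hasDetRepr_holds hrep hnm'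

/-- **pnp.S28 `no_occurrence_obstructions` from BIP Thm. 6.2 alone** (Thm. 6.2 is discharged in
`OccurrenceObstructionsThm62.lean`, which concludes `no_occurrence_obstructions_holds`). For
`n ≥ 4`: partition form of the occurring weight with
`ℓ(λ) ≤ n² + 1` (`exists_partition_of_hasHighestWeight_paddedPerOrbitRep_holds`, BIP Thm. 4.9(1)),
`|λ̄| ≤ n d` (`kadish_landsberg_padding_holds`, BIP Thm. 4.9(2)), the BLMW lift
(`hasHighestWeight_coordRep_of_orbitCoordRep_holds`) and the fresh core
`hasHighestWeight_detOrbitRep_of_fresh`. For `n ≤ 3`: `Z ⊆ Ω_m` (`hasBorderDetRepr_of_le_three`)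
and the occurrence-obstruction principle (`hasHighestWeight_detOrbitRep_of_hasBorderDetRepr`).
[cite: BurgisserIkenmeyerPanovaJAMS2019, Thm. 1.4 and §6 (Proof of Theorem 1.4), adapted to the fresh-variable padding] -/
theorem no_occurrence_obstructions_of_thm_6_2 (h62 : bip2019_thm_6_2) :
    no_occurrence_obstructions := by
  intro n m _ hn hnm χ h
  have hnm' : n ≤ m := (Nat.le_self_pow (by norm_num) n).trans hnm
  by_cases hn4 : 4 ≤ n
  · obtain ⟨d, lam, hℓ, hlam, rfl⟩ :=
      exists_partition_of_hasHighestWeight_paddedPerOrbitRep_holds n m hnm' χ h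
    have hsup : d * (m - n) ≤ lam.parts.sup := kadish_landsberg_padding_holds n m d hnm' lam hlam h
    have hbody : bodySize lam ≤ n * d := by
      unfold bodySize
      have hsplit : d * (m - n) + n * d = d * m := by
        rw [mul_comm n d, ← Nat.mul_add, Nat.sub_add_cancel hnm']
      omega
    have hocc : Literature.NumberTheory.DiophantineGeometry.HasHighestWeight (AlgebraicComplexity.coordRep (Literature.NumberTheory.DiophantineGeometry.MatIdx m) ℂ m)
        (partitionWeightLex m lam) :=
      AlgebraicComplexity.hasHighestWeight_coordRep_of_orbitCoordRep_holds (Literature.NumberTheory.DiophantineGeometry.paddedPerFormLex ℂ n m)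
        (NeZero.ne m) (Literature.NumberTheory.DiophantineGeometry.paddedPerFormLex_isHomogeneous ℂ hnm') h
    exact hasHighestWeight_detOrbitRep_of_fresh h62 hn4 hnm lam hℓ hbody hocc
  · exact hasHighestWeight_detOrbitRep_of_hasBorderDetRepr
      (hasBorderDetRepr_of_le_three hn (by omega) hnm) h

end Literature.Computability.Complexity
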